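import Literature.NumberTheory.EllipticCurves.Rank1Residual.X9NoEntry
import Literature.NumberTheory.EllipticCurves.BurungaleCastellaSkinner2025.HeegnerPointMainConjecture
import Literature.NumberTheory.EllipticCurves.BurungaleCastellaSkinner2025.BDPMainConjecture
import Literature.NumberTheory.EllipticCurves.HeegnerPointsKolyvaginStructure
import Literature.NumberTheory.EllipticCurves.MatarNekovar2019.ShaVanishing
import Literature.NumberTheory.EllipticCurves.MatarNekovar2019.ShaIndexBoundIrreducible
import Literature.NumberTheory.EllipticCurves.MatarNekovar2019.IrreducibleOverQuadraticField
import Literature.NumberTheory.EllipticCurves.HeegnerHypothesisKroneckerProofs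
import Literature.NumberTheory.EllipticCurves.IwasawaLeadingTerm
import Literature.NumberTheory.EllipticCurves.BSDSelmerCMPConverseHeegnerFieldProofs
import HarnessLib

/-!
# Classes X9 / X10b: the DISCHARGE INTERFACE for the Heegner-point / anticyclotomic road and the
# rank-0 Euler characteristic

Print-tier cell `bsd-print-x9` (D-0131 (2), key `x9`), typer seat ty2 — third interface file, companion
of `X9/LeafDischarge.lean` (cyclotomic road: BCS 1.1.2 (a), Kato 17.4, GV (1.4)/Prop 3.7, EPW Thm 1,
W. Zhang 1.4 dead ends) and `X10/LeafDischargeX10b.lean` (the same at `p = 3`); import-independent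
of both. Theorems only: no definition, no new named fact; every published input is an explicit binder
(`hGr`, `hT`, `hBCGS`, `hMN`); the API is declared as dot-notation extensions
`Literature.NumberTheory.EllipticCurves.Rank1Residual.ClassX9.*` / `ClassX10.*` of the census
predicates of `Rank1Residual/Predicates.lean`.

What is discharged here, from the leaf predicate `ClassX9 W p` (`¬cm ∧ GoodOrd W p ∧ 5 ≤ p ∧ Irr W p
∧ ¬Surj W p ∧ …`), are the CLASS-LEVEL binders of the theorems of the Heegner-point road — `p > 3` /
`p ≠ 2`, good ordinary, (irr_ℚ), and the `p = 3` provisos — leaving exactly the per-pair data as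
binders: the Heegner field `K` with (disc)/(Heeg)/(spl) and `p ∤ h_K`, the anticyclotomic datum, the
Heegner point / parametrisation, the torsion condition `E(K)[p] = 0`:

* `ClassX9.greenberg41` — Greenberg LNM 1716 Thm. 4.1 (`greenberg_charValue_rankZero`, rank-`0` Euler
  characteristic; binders `p ≠ 2`, good, `p ∤ a_p` discharged).
* `ClassX9.thm122Hypotheses` — CONSTRUCTOR of Burungale–Castella–Skinner 2025 Thm. 1.2.2's hypothesis
  structure `BurungaleCastellaSkinner2025.Thm122Hypotheses (N_E) W K p κ γ` from the leaf predicate and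
  the `K`-data; with it `thm122a_rankOne_charIdeal_torsion_eq_heegnerCharIdeal_sq_rat` (Thm. 1.2.2 (a),
  RATIONAL, printed under (irr_ℚ) — ALIVE on X9) is applied as `hT (h.thm122Hypotheses …) h.irr D F X`;
  part (b) needs (sur) — dead (`ClassX9.not_surj`). For Thm. 1.2.4 (a)
  (`thm124a_exists_isBDPLFunction_isTorsion_charIdeal_eq_rat`) the binders are individual: apply it
  with `h.three_lt`, `h.goodOrd`, `h.irr`.
* `ClassX9.bcgs_thm1` — Burungale–Castella–Grossi–Skinner 2026 Thm. 1 (Kolyvagin's conjecture under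
  (irr), `BurungaleEtAl2026_exists_kolyvaginClass_ne_zero`): `3 < p`, good, `p ∤ a_p`, Irr discharged;
  left: `K`, (Heeg) for `N_E`, `D_K` odd `≠ −3`, `E(K)[p] = 0`, `p` split.
* `ClassX9.mn67` / `ClassX10.mn67_three` — Matar–Nekovář 2019 Thm. 6.7 (1)
  (`MatarNekovar2019.thm67_sha_primary_trivial_of_irreducible`): `p ≠ 2`, Irr and (on X9) the `p = 3`
  proviso `(K, p) ≠ (ℚ(√−3), 3)` discharged; left: `K`, (Heeg), the Heegner point `y_K ∉ pE(K)`.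
* `ClassX9.mn03` — Matar–Nekovář 2019 Thm. 0.3 index bound
  (`MatarNekovar2019.thm03_padicValNat_card_sha_le_of_irreducible`): `p ≠ 2`, Irr discharged.
* `ClassX9.irr_baseChange_of_mn526` / `ClassX10.irr_three_baseChange_of_mn526` — (irr_K), the
  residual irreducibility OVER THE HEEGNER FIELD asked by BCS Prop. 4.2.2 / JSW Thm. 3.3.1, from
  Matar–Nekovář 2019 Prop. 5.26 (2) (`MatarNekovar2019.prop526_hasIrreducibleModPGaloisRep_baseChange`,
  binder `hMN`): `p ≠ 2`, (irr_ℚ) from the leaf, `(N_E, d_K) = 1` from (Heeg) by the tree theorem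
  `Literature.SatisfiesHeegnerHypothesis.coprime_discr`; left: `K` imaginary quadratic with (Heeg).
* `ClassX9.bcs_prop422` / `ClassX10.bcs_prop422_three` — BCS 2025 Prop. 4.2.2 (`μ(L_p^{BDP}) = 0`,
  `prop422_exists_isBDPLFunction_mu_eq_zero`, binder `hP`): `2 < p` and good discharged; left: the
  `K` / place / anticyclotomic data and (irr_K) (use the previous item).
* `ClassX9.torsionBy_baseChange_eq_bot` / `ClassX10.torsionBy_baseChange_three_eq_bot` — (tor)
  `E(K)[p] = 0` over an imaginary quadratic `K` from (irr_ℚ) (tree theorem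
  `torsionBy_eq_bot_of_isImaginaryQuadratic_of_hasIrreducibleModPGaloisRep`); with it
  `ClassX9.bcgs_thm1_of_isImaginaryQuadratic` = BCGS Thm. 1 with (tor) discharged as well.

Nothing is asserted about any curve; X9 / X10b keep their labels.

## References (hypotheses quoted from the tree's fact docstrings, which carry the page locators)

* [GreenbergLNM1716] Thm. 4.1 (p. 85): good ordinary, `Sel` finite, `f_E` a characteristic generator.
* [BurungaleCastellaSkinner2025] Thm. 1.2.2 (a)/(b), Thm. 1.2.4 (a) (§1.2, p. 3 of arXiv:2405.00270v2):
  `p > 3` good ordinary, (irr_ℚ) / (sur), `K` with (disc), (Heeg), (spl).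
* [BurungaleEtAl2026] Thm. 1 (arXiv:2312.09301 §0.1, pp. 3–4): `p > 3`, (irr), (Heeg), (disc), `E(K)[p] = 0`, `p` split.
* [MatarNekovar2019] Thm. 6.7 (1) (p. 498), Thm. 0.3 with §0.4: `p ≠ 2`, `E[p]` irreducible, Heegner `K`;
  Prop. 5.26 (2) (p. 492): quadratic `K` with `(N, D_K) = 1`, `p ≠ 2`, `ρ̄` irreducible.
* [BurungaleCastellaSkinner2025] Prop. 4.2.2 (§4.2, p. 8): odd good ordinary `p`, `K` with (Heeg), (spl), (disc), (irr_K).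
-/

noncomputable section

open scoped Classical

open WeierstrassCurve Field NumberField IsDedekindDomain Literature.NumberTheory.EllipticCurves
  Literature.NumberTheory.EllipticCurves.ModularForms

universe u

namespace Literature.NumberTheory.EllipticCurves.Rank1Residual

section X9

variable {W : WeierstrassCurve ℚ} [W.IsGloballyMinimal] {p : ℕ} [Fact p.Prime]

/-- **Greenberg LNM 1716 Thm. 4.1 on X9** (`greenberg_charValue_rankZero`, binder `hGr`): at an X9
pair, for a cyclotomic datum `(κ, γ)`, a torsion dual datum `D` with `char X = (f_E)` and
`Sel_{p^∞}(E/ℚ)` finite, `f_E(0) · #E(ℚ)(p)² = u · p^{ord_p ∏ c_ℓ} · #Ẽ(𝔽_p)(p)² · #Sel_{p^∞}(E/ℚ)`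
for a unit `u`; binders `p ≠ 2`, good, `p ∤ a_p` discharged from the leaf predicate.
[cite: GreenbergLNM1716, Thm. 4.1 (p. 85)] -/
theorem ClassX9.greenberg41 [W.IsElliptic] (hGr : greenberg_charValue_rankZero) (h : ClassX9 W p)
    (κ : ZpExtension ℚ p) (γ : Field.absoluteGaloisGroup ℚ)
    (hκ : κ.IsCyclotomic) (hγ : κ.IsTopGenerator γ) (hγ' : IsCyclotomicVariable p γ)
    (D : W.SelmerDualData κ γ) [Module.Finite (IwasawaAlgebra p) D.X] (hD : D.IsTorsion)
    (fE : IwasawaAlgebra p) (hfE : D.charIdeal = Ideal.span {fE})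
    (hfin : Finite (W.selmerGroupPInfty p)) :
    ∃ u : ℤ_[p]ˣ,
      ((PowerSeries.constantCoeff fE : ℤ_[p]) : ℚ_[p]) *
          (Nat.card (AddCommGroup.primaryComponent W.toAffine.Point p) : ℚ_[p]) ^ 2 =
        ((u : ℤ_[p]) : ℚ_[p]) * (p : ℚ_[p]) ^ (padicValNat p W.tamagawaProduct) *
          (Nat.card (AddCommGroup.primaryComponent
            ((integralModelInt W).map (Int.castRingHom (ZMod p))).toAffine.Point p) : ℚ_[p]) ^ 2 *
          (Nat.card (W.selmerGroupPInfty p) : ℚ_[p]) :=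
  hGr W p (by have := h.2.2.1; omega) h.2.1.1 h.2.1.2 κ γ hκ hγ hγ' D hD fE hfE hfin

/-- **Constructor of the hypothesis structure of BCS 2025 Thm. 1.2.2 at an X9 pair**
(`BurungaleCastellaSkinner2025.Thm122Hypotheses (N_E) W K p κ γ`): the class-level fields `p > 3`
and good ordinary come from the leaf predicate, the level is the conductor, and the remaining fields
are the per-pair `K`-data — `K` imaginary quadratic with (disc) `D_K` odd, `D_K ≠ −3`, (Heeg) for
`N_E`, (spl) `p` split, the tree's extra `p ∤ h_K`, and the anticyclotomic datum `(κ, γ)`. With it,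
Thm. 1.2.2 (a) (`thm122a_…_rat`, binder `hT`) is applied as `hT (h.thm122Hypotheses …) h.irr D F X`.
[cite: BurungaleCastellaSkinner2025, Thm. 1.2.2 (data) with (disc), (Heeg), (spl) (§1.2, pp. 2–3 of arXiv:2405.00270v2)] -/
theorem ClassX9.thm122Hypotheses [hE : W.IsElliptic] (h : ClassX9 W p)
    {K : Type u} [Field K] [NumberField K] (κ : ZpExtension K p) (γ : Field.absoluteGaloisGroup K)
    [NeZero (W.conductorNorm ℤ)]
    (hK : IsImaginaryQuadratic K) (hodd : Odd (discr K)) (hne : discr K ≠ -3)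
    (hHeeg : SatisfiesHeegnerHypothesis (W.conductorNorm ℤ) K)
    (hspl : ((Ideal.span {(p : ℤ)}).primesOver (𝓞 K)).ncard = 2)
    (hh : ¬ p ∣ classNumber K) (hac : κ.IsAnticyclotomic) (hγ : κ.IsTopGenerator γ) :
    BurungaleCastellaSkinner2025.Thm122Hypotheses (W.conductorNorm ℤ) W K p κ γ where
  isElliptic := hE
  level := rfl
  three_lt := by have := h.2.2.1; omega
  goodOrd := h.2.1
  isImaginaryQuadratic := hK
  discr_odd := hodd
  discr_ne := hne
  heegner := hHeeg
  split := hspl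
  not_dvd_classNumber := hh
  anticyclotomic := hac
  topGenerator := hγ

/-- **Burungale–Castella–Grossi–Skinner 2026 Thm. 1 (Kolyvagin's conjecture under (irr)) on X9**
(`BurungaleEtAl2026_exists_kolyvaginClass_ne_zero`, binder `hBCGS`): at an X9 pair, for every
imaginary quadratic `K` with (Heeg) for `N_E`, `D_K` odd and `≠ −3`, `E(K)[p] = 0` and `p` split in
`K`, some Kolyvagin class `c_M(n) ≠ 0`; binders `3 < p`, good, `p ∤ a_p`, (irr) discharged from the
leaf predicate. [cite: BurungaleEtAl2026, Thm. 1 (arXiv:2312.09301 §0.1, pp. 3–4)] -/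
theorem ClassX9.bcgs_thm1 [W.IsElliptic] (hBCGS : BurungaleEtAl2026_exists_kolyvaginClass_ne_zero)
    (h : ClassX9 W p) (K : Type) [Field K] [NumberField K] (hK : IsImaginaryQuadratic K)
    [NeZero (W.conductorNorm ℤ)] (hHeeg : SatisfiesHeegnerHypothesis (W.conductorNorm ℤ) K)
    (hodd : Odd (NumberField.discr K)) (hne : NumberField.discr K ≠ -3)
    (htor : AddSubgroup.torsionBy (W.baseChange K).toAffine.Point (p : ℤ) = ⊥)
    (hsplit : SatisfiesHeegnerHypothesis p K) :
    ∃ (Dt : ModularParametrizationData W (W.conductorNorm ℤ)) (β : ℤ) (ι : K →+* ℂ) (n : ℕ)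
      (d : KolyvaginHeegnerData Dt β ι n) (M : ℕ),
      KolyvaginDescent.KolSupp (Zhang2014.IsKolyvaginPrime (W.conductorNorm ℤ) W K p) n ∧
        1 ≤ M ∧ (M : ℕ∞) ≤ Zhang2014.levelIndex W p n ∧
          d.kolyvaginClass (Fact.out : p.Prime) M ≠ 0 :=
  hBCGS W p (by have := h.2.2.1; omega) h.2.1.1 h.2.1.2 h.2.2.2.1 K hK hHeeg hodd hne htor hsplit

/-- **Matar–Nekovář 2019 Thm. 6.7 (1) on X9** (`MatarNekovar2019.thm67_sha_primary_trivial_of_irreducible`,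
binder `hMN`): at an X9 pair, for a Heegner field `K` of level `N` and a Heegner point `y_K ∉ pE(K)`,
`Ш(E/K)[p^∞] = 0`; binders `p` prime, `p ≠ 2`, (irr) and the proviso "`p = 3 ⇒ D_K ≠ −3`" (vacuous:
`p ≥ 5`) discharged from the leaf predicate. [cite: MatarNekovar2019, Thm. 6.7 (1) (p. 498)] -/
theorem ClassX9.mn67 [W.IsElliptic] {N : ℕ} [NeZero N] {K : Type u} [Field K] [NumberField K]
    (hMN : MatarNekovar2019.thm67_sha_primary_trivial_of_irreducible N W K) (h : ClassX9 W p)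
    (hK : IsImaginaryQuadratic K) (hH : SatisfiesHeegnerHypothesis N K)
    {P : (W.baseChange K).toAffine.Point} (hP : IsHeegnerPoint N W K P)
    (hdiv : ¬ ∃ Q : (W.baseChange K).toAffine.Point, p • Q = P) :
    ∀ (x : (W.baseChange K).sha) (n : ℕ), (p ^ n) • x = 0 → x = 0 :=
  hMN hK hH hP (Fact.out : p.Prime) (by have := h.2.2.1; omega) h.2.2.2.1
    (fun h3 => by have := h.2.2.1; omega) hdiv

/-- **Matar–Nekovář 2019 Thm. 0.3 (index bound) on X9**
(`MatarNekovar2019.thm03_padicValNat_card_sha_le_of_irreducible`, binder `hMN`): at an X9 pair, for a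
Heegner field `K` of level `N` with `D_K ≠ −3, −4` and a Heegner point `P` of infinite order,
`ord_p #Ш(E/K) ≤ 2 · ord_p [E(K) : ℤP]`; binders `p` prime, `p ≠ 2`, (irr) discharged from the leaf
predicate. [cite: MatarNekovar2019, Thm. 0.3 with §0.4 (index bound, irreducible image)] -/
theorem ClassX9.mn03 [W.IsElliptic] {N : ℕ} [NeZero N] {K : Type u} [Field K] [NumberField K]
    (hMN : MatarNekovar2019.thm03_padicValNat_card_sha_le_of_irreducible N W K) (h : ClassX9 W p)
    (hK : IsImaginaryQuadratic K) (hH : SatisfiesHeegnerHypothesis N K)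
    (hD3 : NumberField.discr K ≠ -3) (hD4 : NumberField.discr K ≠ -4)
    {P : (W.baseChange K).toAffine.Point} (hP : IsHeegnerPoint N W K P) (hnt : ¬ IsOfFinAddOrder P) :
    padicValNat p (Nat.card ((W.baseChange K).sha)) ≤
      2 * padicValNat p (AddSubgroup.zmultiples P).index :=
  hMN hK hH hD3 hD4 hP hnt (Fact.out : p.Prime) (by have := h.2.2.1; omega) h.2.2.2.1

/-- **(irr_K) on X9 from Matar–Nekovář 2019 Prop. 5.26 (2)**
(`MatarNekovar2019.prop526_hasIrreducibleModPGaloisRep_baseChange`, binder `hMN`): at an X9 pair,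
for every imaginary quadratic `K` satisfying (Heeg) for `N_E`, `E[p]` stays irreducible as a
`G_K`-module — the (irr_K) binder of BCS Prop. 4.2.2 / Thm. 4.2.1 and of JSW Thm. 3.3.1. Discharged:
`p ≠ 2` and (irr_ℚ) from the leaf predicate, `(N_E, d_K) = 1` from (Heeg)
(`Literature.SatisfiesHeegnerHypothesis.coprime_discr`). [cite: MatarNekovar2019, Prop. 5.26 (2) (p. 492)] -/
theorem ClassX9.irr_baseChange_of_mn526 [W.IsElliptic]
    (hMN : MatarNekovar2019.prop526_hasIrreducibleModPGaloisRep_baseChange) (h : ClassX9 W p)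
    (K : Type) [Field K] [NumberField K] (hK : IsImaginaryQuadratic K)
    (hHeeg : SatisfiesHeegnerHypothesis (W.conductorNorm ℤ) K) :
    (W.baseChange K).HasIrreducibleModPGaloisRep p :=
  hMN W K hK.1 (Literature.SatisfiesHeegnerHypothesis.coprime_discr hK.1 hHeeg) p
    (by have := h.2.2.1; omega) h.2.2.2.1

/-- **BCS 2025 Prop. 4.2.2 (`μ(L_p^{BDP}(f/K)) = 0`) on X9** (`prop422_exists_isBDPLFunction_mu_eq_zero`,
binder `hP`): at an X9 pair, for the per-pair data — `K` imaginary quadratic with (Heeg) for the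
level, (spl), (disc), a place `v ∣ p` matched to `ι'`, the anticyclotomic datum `(κ, γ)` and (irr_K)
(`ClassX9.irr_baseChange_of_mn526`) — the BDP `p`-adic `L`-function exists with a unit coefficient.
Discharged: `2 < p`, good reduction at `p`. [cite: BurungaleCastellaSkinner2025, Prop. 4.2.2 (§4.2, p. 8 of arXiv:2405.00270v2)] -/
theorem ClassX9.bcs_prop422 [W.IsElliptic]
    (hP : BurungaleCastellaSkinner2025.prop422_exists_isBDPLFunction_mu_eq_zero) (h : ClassX9 W p)
    (ι' : PadicAlgCl p ≃+* ℂ) (K : Type) [Field K] [NumberField K] (v : HeightOneSpectrum (𝓞 K))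
    (κ : ZpExtension K p) (γ : Field.absoluteGaloisGroup K) {N : ℕ} [NeZero N]
    {f : CuspForm (CongruenceSubgroup.Gamma0 N) 2} (hf : IsNewformOf W f)
    (hK : IsImaginaryQuadratic K) (hHeeg : SatisfiesHeegnerHypothesis N K)
    (hspl : ((Ideal.span {(p : ℤ)}).primesOver (𝓞 K)).ncard = 2)
    (hodd : Odd (NumberField.discr K)) (hne : NumberField.discr K ≠ -3)
    (hirrK : (W.baseChange K).HasIrreducibleModPGaloisRep p)
    (hv : ((p : ℕ) : 𝓞 K) ∈ v.asIdeal)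
    (hv' : ∀ (w : InfinitePlace K) (k : 𝓞 K), k ∈ v.asIdeal ↔ ‖ι'.symm (w.embedding (k : K))‖ < 1)
    (hac : κ.IsAnticyclotomic) (hγ : κ.IsTopGenerator γ) :
    ∃ (ΩK : ℂ) (Ωp : (unrIntegers p)ˣ) (L : UnrSeries p),
      ΩK ≠ 0 ∧ IsBDPLFunction ι' v κ γ f ΩK ((Ωp : unrIntegers p) : ℂ_[p]) L ∧
      ∃ k : ℕ, IsUnit (PowerSeries.coeff k L) :=
  hP ι' W K v κ γ hf (by have := h.2.2.1; omega) h.2.1.1 hK hHeeg hspl hodd hne hirrK hv hv' hac hγ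

/-- **(tor) on X9: `E(K)[p] = 0` over every imaginary quadratic `K`** — from (irr_ℚ) and `p` prime
(tree theorem `torsionBy_eq_bot_of_isImaginaryQuadratic_of_hasIrreducibleModPGaloisRep`, Gross 1991
§2). This is hypothesis (tor) of BCGS 2026 Thm. 1 and step (1) of the PrintX9 assembly.
[cite: BurungaleEtAl2026, Thm. 1 (hypothesis (tor)) (arXiv:2312.09301 §0.1)] -/
theorem ClassX9.torsionBy_baseChange_eq_bot [W.IsElliptic] (h : ClassX9 W p)
    (K : Type u) [Field K] [NumberField K] (hK : IsImaginaryQuadratic K) :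
    AddSubgroup.torsionBy (W.baseChange K).toAffine.Point (p : ℤ) = ⊥ :=
  torsionBy_eq_bot_of_isImaginaryQuadratic_of_hasIrreducibleModPGaloisRep W K hK
    (Fact.out : p.Prime) h.2.2.2.1

/-- **BCGS 2026 Thm. 1 on X9 with (tor) discharged** (`ClassX9.bcgs_thm1` composed with
`ClassX9.torsionBy_baseChange_eq_bot`): left as binders are only `K` imaginary quadratic with (Heeg)
for `N_E`, `D_K` odd `≠ −3`, and `p` split in `K`. [cite: BurungaleEtAl2026, Thm. 1 (arXiv:2312.09301 §0.1, pp. 3–4)] -/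
theorem ClassX9.bcgs_thm1_of_isImaginaryQuadratic [W.IsElliptic]
    (hBCGS : BurungaleEtAl2026_exists_kolyvaginClass_ne_zero)
    (h : ClassX9 W p) (K : Type) [Field K] [NumberField K] (hK : IsImaginaryQuadratic K)
    [NeZero (W.conductorNorm ℤ)] (hHeeg : SatisfiesHeegnerHypothesis (W.conductorNorm ℤ) K)
    (hodd : Odd (NumberField.discr K)) (hne : NumberField.discr K ≠ -3)
    (hsplit : SatisfiesHeegnerHypothesis p K) :
    ∃ (Dt : ModularParametrizationData W (W.conductorNorm ℤ)) (β : ℤ) (ι : K →+* ℂ) (n : ℕ)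
      (d : KolyvaginHeegnerData Dt β ι n) (M : ℕ),
      KolyvaginDescent.KolSupp (Zhang2014.IsKolyvaginPrime (W.conductorNorm ℤ) W K p) n ∧
        1 ≤ M ∧ (M : ℕ∞) ≤ Zhang2014.levelIndex W p n ∧
          d.kolyvaginClass (Fact.out : p.Prime) M ≠ 0 :=
  h.bcgs_thm1 hBCGS K hK hHeeg hodd hne (h.torsionBy_baseChange_eq_bot K hK) hsplit

end X9

section X10b

variable {W : WeierstrassCurve ℚ} [W.IsGloballyMinimal] {p : ℕ} [Fact p.Prime]

/-- **Greenberg LNM 1716 Thm. 4.1 on X10 at `3`** (`greenberg_charValue_rankZero`, binder `hGr`):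
binders `3 ≠ 2`, good, `3 ∤ a_3` discharged from `ClassX10`. [cite: GreenbergLNM1716, Thm. 4.1 (p. 85)] -/
theorem ClassX10.greenberg41_three [W.IsElliptic] (hGr : greenberg_charValue_rankZero) (h : ClassX10 W p)
    (κ : ZpExtension ℚ 3) (γ : Field.absoluteGaloisGroup ℚ)
    (hκ : κ.IsCyclotomic) (hγ : κ.IsTopGenerator γ) (hγ' : IsCyclotomicVariable 3 γ)
    (D : W.SelmerDualData κ γ) [Module.Finite (IwasawaAlgebra 3) D.X] (hD : D.IsTorsion)
    (fE : IwasawaAlgebra 3) (hfE : D.charIdeal = Ideal.span {fE})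
    (hfin : Finite (W.selmerGroupPInfty 3)) :
    ∃ u : ℤ_[3]ˣ,
      ((PowerSeries.constantCoeff fE : ℤ_[3]) : ℚ_[3]) *
          (Nat.card (AddCommGroup.primaryComponent W.toAffine.Point 3) : ℚ_[3]) ^ 2 =
        ((u : ℤ_[3]) : ℚ_[3]) * (3 : ℚ_[3]) ^ (padicValNat 3 W.tamagawaProduct) *
          (Nat.card (AddCommGroup.primaryComponent
            ((integralModelInt W).map (Int.castRingHom (ZMod 3))).toAffine.Point 3) : ℚ_[3]) ^ 2 *
          (Nat.card (W.selmerGroupPInfty 3) : ℚ_[3]) := by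
  exact_mod_cast hGr W 3 (by decide) h.2.1.1 h.2.1.2 κ γ hκ hγ hγ' D hD fE hfE hfin

/-- **Matar–Nekovář 2019 Thm. 6.7 (1) on X10b at `3`** (binder `hMN`): here the proviso
"`p = 3 ⇒ D_K ≠ −3`" is a genuine per-pair condition on the Heegner field (`hD3`); `3 ≠ 2` and
(irr) at `3` discharged from `ClassX10`. [cite: MatarNekovar2019, Thm. 6.7 (1) (p. 498)] -/
theorem ClassX10.mn67_three [W.IsElliptic] {N : ℕ} [NeZero N] {K : Type u} [Field K] [NumberField K]
    (hMN : MatarNekovar2019.thm67_sha_primary_trivial_of_irreducible N W K) (h : ClassX10 W p)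
    (hK : IsImaginaryQuadratic K) (hH : SatisfiesHeegnerHypothesis N K) (hD3 : NumberField.discr K ≠ -3)
    {P : (W.baseChange K).toAffine.Point} (hP : IsHeegnerPoint N W K P)
    (hdiv : ¬ ∃ Q : (W.baseChange K).toAffine.Point, 3 • Q = P) :
    ∀ (x : (W.baseChange K).sha) (n : ℕ), (3 ^ n) • x = 0 → x = 0 :=
  hMN hK hH hP Nat.prime_three (by decide) h.2.2.1 (fun _ => hD3) hdiv

/-- **Matar–Nekovář 2019 Thm. 0.3 on X10 at `3`** (binder `hMN`): `3 ≠ 2` and (irr) at `3`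
discharged. [cite: MatarNekovar2019, Thm. 0.3 with §0.4 (index bound, irreducible image)] -/
theorem ClassX10.mn03_three [W.IsElliptic] {N : ℕ} [NeZero N] {K : Type u} [Field K] [NumberField K]
    (hMN : MatarNekovar2019.thm03_padicValNat_card_sha_le_of_irreducible N W K) (h : ClassX10 W p)
    (hK : IsImaginaryQuadratic K) (hH : SatisfiesHeegnerHypothesis N K)
    (hD3 : NumberField.discr K ≠ -3) (hD4 : NumberField.discr K ≠ -4)
    {P : (W.baseChange K).toAffine.Point} (hP : IsHeegnerPoint N W K P) (hnt : ¬ IsOfFinAddOrder P) :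
    padicValNat 3 (Nat.card ((W.baseChange K).sha)) ≤
      2 * padicValNat 3 (AddSubgroup.zmultiples P).index :=
  hMN hK hH hD3 hD4 hP hnt Nat.prime_three (by decide) h.2.2.1

/-- **(irr_K) on X10 at `3` from Matar–Nekovář 2019 Prop. 5.26 (2)** (binder `hMN`): `3 ≠ 2`,
(irr_ℚ) at `3` from `ClassX10`, `(N_E, d_K) = 1` from (Heeg). [cite: MatarNekovar2019, Prop. 5.26 (2) (p. 492)] -/
theorem ClassX10.irr_three_baseChange_of_mn526 [W.IsElliptic]
    (hMN : MatarNekovar2019.prop526_hasIrreducibleModPGaloisRep_baseChange) (h : ClassX10 W p)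
    (K : Type) [Field K] [NumberField K] (hK : IsImaginaryQuadratic K)
    (hHeeg : SatisfiesHeegnerHypothesis (W.conductorNorm ℤ) K) :
    (W.baseChange K).HasIrreducibleModPGaloisRep 3 :=
  hMN W K hK.1 (Literature.SatisfiesHeegnerHypothesis.coprime_discr hK.1 hHeeg) 3 (by decide) h.2.2.1

/-- **BCS 2025 Prop. 4.2.2 on X10 at `3`** (binder `hP`; printed for odd good ordinary `p`, so
`p = 3` is inside): `2 < 3` and good reduction at `3` discharged from `ClassX10`.
[cite: BurungaleCastellaSkinner2025, Prop. 4.2.2 (§4.2, p. 8 of arXiv:2405.00270v2)] -/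
theorem ClassX10.bcs_prop422_three [W.IsElliptic]
    (hP : BurungaleCastellaSkinner2025.prop422_exists_isBDPLFunction_mu_eq_zero) (h : ClassX10 W p)
    (ι' : PadicAlgCl 3 ≃+* ℂ) (K : Type) [Field K] [NumberField K] (v : HeightOneSpectrum (𝓞 K))
    (κ : ZpExtension K 3) (γ : Field.absoluteGaloisGroup K) {N : ℕ} [NeZero N]
    {f : CuspForm (CongruenceSubgroup.Gamma0 N) 2} (hf : IsNewformOf W f)
    (hK : IsImaginaryQuadratic K) (hHeeg : SatisfiesHeegnerHypothesis N K)
    (hspl : ((Ideal.span {((3 : ℕ) : ℤ)}).primesOver (𝓞 K)).ncard = 2)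
    (hodd : Odd (NumberField.discr K)) (hne : NumberField.discr K ≠ -3)
    (hirrK : (W.baseChange K).HasIrreducibleModPGaloisRep 3)
    (hv : (((3 : ℕ) : ℕ) : 𝓞 K) ∈ v.asIdeal)
    (hv' : ∀ (w : InfinitePlace K) (k : 𝓞 K), k ∈ v.asIdeal ↔ ‖ι'.symm (w.embedding (k : K))‖ < 1)
    (hac : κ.IsAnticyclotomic) (hγ : κ.IsTopGenerator γ) :
    ∃ (ΩK : ℂ) (Ωp : (unrIntegers 3)ˣ) (L : UnrSeries 3),
      ΩK ≠ 0 ∧ IsBDPLFunction ι' v κ γ f ΩK ((Ωp : unrIntegers 3) : ℂ_[3]) L ∧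
      ∃ k : ℕ, IsUnit (PowerSeries.coeff k L) :=
  hP ι' W K v κ γ hf (by decide) h.2.1.1 hK hHeeg hspl hodd hne hirrK hv hv' hac hγ

/-- **(tor) on X10 at `3`: `E(K)[3] = 0` over every imaginary quadratic `K`** from (irr_ℚ) at `3`.
[cite: BurungaleEtAl2026, Thm. 1 (hypothesis (tor)) (arXiv:2312.09301 §0.1)] -/
theorem ClassX10.torsionBy_baseChange_three_eq_bot [W.IsElliptic] (h : ClassX10 W p)
    (K : Type u) [Field K] [NumberField K] (hK : IsImaginaryQuadratic K) :
    AddSubgroup.torsionBy (W.baseChange K).toAffine.Point ((3 : ℕ) : ℤ) = ⊥ :=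
  torsionBy_eq_bot_of_isImaginaryQuadratic_of_hasIrreducibleModPGaloisRep W K hK Nat.prime_three
    h.2.2.1

end X10b

end Literature.NumberTheory.EllipticCurves.Rank1Residual
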